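import Summits.RiemannHypothesis.RiemannHypothesis.Theorems.TiltedLandingLaw421R3TouchedDissipation
import Summits.RiemannHypothesis.RiemannHypothesis.Theorems.TiltedLandingLaw421R3ColumnImmunity

/-!
# T⁗ — the FRAME-WEIGHTED log-profile dissipation SOCKET `TouchedDissipationLawWQ cF L κ₀` and its instance `TouchedDissipationLawTQ c L κ₀ θ`
(lens-2 g7; TYPED per (CA680)(D2) after CUT 34; memo `lens2/TQ-FRAMEWISE-MEMO-v1.md` ad1b401b, decldiff `lens2/GLUE-V5-DECLDIFF-v1.md` f8dc3f57; a LAW, unproved)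
ONE tree import (C′ module `…R3TouchedDissipation`, #1178).  Self-contained: the log weight `logWeight` of the dead T‴ draft (`lens2/TouchedDissipationL-v1.lean`
64d6c277, never landed) is re-homed here (§1).  PARAMETERS: `c` (dissipation constant), `L` (log slope), `κ₀` (field floor) — binders; `θ` (weight slope) a
binder of the general instance, with the value of record `thetaW = 2` a binder-free def (§1, justified there); NOTHING ELSE BAKED.
STATEMENT.  Same population as C′/T‴ (legal frame; CHARGED APPROACH level `j`; lowest band state `v` touched by a strictly taller zero `z` of `f⁽ʲ⁾`; the
pair atomic; `κ₀ ≤ Im v·κ_v`); with `e := Im v² + Im z²`, `y(e) := 1 + L·log(2Hs²/e)`:   `cF(F)·s² ≤ η²·y(e)²·(e − childEnergy Ū)`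
— T‴'s inequality VERBATIM with the global constant `c` replaced by a FRAME FUNCTIONAL `cF : Budget` (a function of the datum `(η,f,x₀,s,hmax,R,Hs,B)`
only, like every budget of the books).  [Erratum to the decldiff's one-liner, which put `y²` on the left: the benches' merit is `M_row(L) = X″·y²`, so `y²`
multiplies `ΔE`, as in T‴ and in the glue's paying inequality.]  T⁗ = the instance `cF := c / w_F`, `w_F := max(1, θ·(B+1)·(s/Hs)²)` (`frameWeightQ`):
big-`B` frames (one-sided fences, towers: B ≈ 60–110·(Hs/s)²) get the SMALL constant; balanced frames (`w_F = 1`) must carry `c` itself.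
BENCH OF RECORD (crit-1 CUT 34, (CA680), floats): decision number min over LEGAL ∧ CHARGED rows of `M_row(L)·w_F/need(.66, L)` = ×4.2 (row «W2F», L = 0)
among balanced frames, ≥ ×30 among one-sided frames; my predicted killer «W2F-tall» was neither legal nor charged; next adversary named: «W2F-sparse» (l.8232).
KILL: a legal charged atomic approach β-row with `X″·y_L(u)²·w_F < c` at the instance under test.
Nothing here bears on the truth of RH; RH is not proved; T⁗ is a typed LAW (OPEN), it survived ONE cut as a candidate; T″/T‴ dead; C′ typed not proved;
★A / 33346 / 33347 OPEN; checked ≠ landed ≠ proved. -/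

namespace RhW08.TouchedDissipationW

open Complex
open scoped ComplexConjugate
open RhW08.Round1 RhW08.StSwap RhW08.Round2 RhW08.QuadW
open RhW08.SealSwap (PBot)
open RhW08.SealSwapQ RhW08.RateSplit RhW08.BurgersRate RhW08.BurgersRateG3 RhW08.TouchedDissipation
open RhIdea6.G17.W07C7 RhIdea6.G17.W07C7.Rev6 RhIdea6.G18.W07C8.Law421BirthS RhIdea6.G19.W07C11.Seam
open RhIdea6.G20.W07C12.Frac RhIdea6.G20.W07C12.StColP RhW07.C12.FieldSplit RhIdea6.G21.W07C13.TentMax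
open RhW07.C14.TwoSided RhW07.C14.Classes RhW07.C14.Lineage RhW07.C14.Booking

/-! ## §1 Weights -/

/-- §1 the LOG-PROFILE WEIGHT `y(E) = 1 + L·log(2Hs²/E)` of an energy `E` in a strip of height `Hs` (`= 1` at `E = 2Hs²`; Lean junk: `E = 0 ⇒ y = 1`). -/
noncomputable def logWeight (L Hs E : ℝ) : ℝ := 1 + L * Real.log (2 * Hs ^ 2 / E)

/-- §1 the FRAME WEIGHT `w_F := max(1, θ·(B+1)·(s/Hs)²)` — a `Budget` (function of the frame datum only); `≥ 1`; reads `1` whenever `θ·(B+1) ≤ (Hs/s)²`. -/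
noncomputable def frameWeightQ (θ : ℝ) : Budget := fun _η _f _x₀ s _hmax _R Hs B => max 1 (θ * ((B : ℝ) + 1) * (s / Hs) ^ 2)

/-- §1 the WEIGHTED CONSTANT `c_F := c / w_F`. -/
noncomputable def weightedConstQ (c θ : ℝ) : Budget := fun η f x₀ s hmax R Hs B => c / frameWeightQ θ η f x₀ s hmax R Hs B

/-- §1 the weight slope OF RECORD `θ_W := 2` (binder-free).  WHY THIS VALUE, and why it is not a hand-picked truth threshold (checklist 4c(iv)): the law
`TouchedDissipationLawTQ c L κ₀ θ` is WEAKER for LARGER `θ` (`lawTQ_mono_theta`), so `θ` is capped only by what the BOOKS can pay: FIT_W's B-bracket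
(`approachBudgetHalfQ` carries `(3/2)·(B+1)` of capital per frame, `approachBudgetHalf_apply`) reads `φ₀·θ ≤ 3/2` with `φ₀ = (1+2L+2L²)/(2c)`, i.e.
`θ ≤ 3/(2φ₀) ∈ [2, 2.5]` on the purse factors of record `φ₀ ∈ [0.6, 0.75]`; `2` is the largest value payable across that whole range.  Any other `θ` is
another INSTANCE of the socket, not an edit of this file. -/
def thetaW : ℝ := 2

/-! ## §2 The socket and the law (parameters only; nothing instantiated numerically except `thetaW`) -/

/-- (SOCKET W — FRAME-WEIGHTED LOG-PROFILE DISSIPATION ON TOUCHED APPROACH LEVELS; typed, OPEN) for a frame functional `cF`: on a legal frame, at a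
CHARGED APPROACH level `j` whose lowest band state `v` is touched by a strictly taller zero `z` of `f⁽ʲ⁾` (`Touches`), the pair atomic (`AtomicPair`),
the state field above the floor (`κ₀ ≤ Im v·κ_v`): `cF(F)·s² ≤ η²·(1 + L·log(2Hs²/(Im v² + Im z²)))²·((Im v² + Im z²) − childEnergy(Ū))`. -/
def TouchedDissipationLawWQ (cF : Budget) (L κ₀ : ℝ) : Prop :=
  ∀ (η : ℝ) (f : ℂ → ℂ) (x₀ s hmax R Hs : ℝ) (B : ℕ), EngineHyps5 2 η f x₀ s hmax R Hs B →
    ∀ (j : ℕ) (v z : ℂ), Charged (PTrkSQ PBot) StTrkDQ ReadyR2 η f x₀ s hmax R Hs B j → ApproachLevelQ η f x₀ s hmax R Hs B j →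
      IsLowest StTrkDQ η f x₀ s hmax R Hs B j v → Touches f j v z → AtomicPair f j v z →
      κ₀ ≤ v.im * stateKappa f j v →
      cF η f x₀ s hmax R Hs B * s ^ 2
        ≤ η ^ 2 * logWeight L Hs (v.im ^ 2 + z.im ^ 2) ^ 2 * ((v.im ^ 2 + z.im ^ 2) - childEnergy f j (pairUnion v z))

/-- (LAW T⁗(c, L, κ₀, θ) — typed, OPEN) the socket at the weighted constant `c / max(1, θ·(B+1)·(s/Hs)²)`. -/
def TouchedDissipationLawTQ (c L κ₀ θ : ℝ) : Prop := TouchedDissipationLawWQ (weightedConstQ c θ) L κ₀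

/-- (LAW T⁗ OF RECORD — `θ = thetaW = 2`; `c, L, κ₀` parameters) -/
def TouchedDissipationLawTWQ (c L κ₀ : ℝ) : Prop := TouchedDissipationLawTQ c L κ₀ thetaW

/-! ## §3 Bookkeeping (K) -/

/-- (K) `y(2Hs²) = 1` (also for `Hs = 0`). -/
theorem logWeight_top (L Hs : ℝ) : logWeight L Hs (2 * Hs ^ 2) = 1 := by
  unfold logWeight
  by_cases h : 2 * Hs ^ 2 = 0
  · rw [h]; simp
  · rw [div_self h, Real.log_one]; ring

/-- (K) `1 ≤ y(E)` for `0 ≤ L`, `0 < E ≤ 2Hs²`. -/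
theorem one_le_logWeight {L Hs E : ℝ} (hL : 0 ≤ L) (hE : 0 < E) (hEA : E ≤ 2 * Hs ^ 2) : 1 ≤ logWeight L Hs E := by
  unfold logWeight
  have hlog : 0 ≤ Real.log (2 * Hs ^ 2 / E) := Real.log_nonneg ((one_le_div hE).2 hEA)
  nlinarith

/-- (K) `1 ≤ w_F`, hence `0 < w_F`. -/
theorem one_le_frameWeightQ (θ η : ℝ) (f : ℂ → ℂ) (x₀ s hmax R Hs : ℝ) (B : ℕ) : 1 ≤ frameWeightQ θ η f x₀ s hmax R Hs B :=
  le_max_left _ _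

/-- (K) the frame weight is positive. -/
theorem frameWeightQ_pos (θ η : ℝ) (f : ℂ → ℂ) (x₀ s hmax R Hs : ℝ) (B : ℕ) : 0 < frameWeightQ θ η f x₀ s hmax R Hs B :=
  one_pos.trans_le (one_le_frameWeightQ θ η f x₀ s hmax R Hs B)

/-- (K) `w_F ≤ 1 + θ·(B+1)·(s/Hs)²` for `0 ≤ θ` (the form FIT_W's two brackets use). -/
theorem frameWeightQ_le {θ : ℝ} (hθ : 0 ≤ θ) (η : ℝ) (f : ℂ → ℂ) (x₀ s hmax R Hs : ℝ) (B : ℕ) :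
    frameWeightQ θ η f x₀ s hmax R Hs B ≤ 1 + θ * ((B : ℝ) + 1) * (s / Hs) ^ 2 := by
  have h0 : 0 ≤ θ * ((B : ℝ) + 1) * (s / Hs) ^ 2 := by positivity
  exact max_le (by linarith) (by linarith)

/-- (K) `w_F` is monotone in `θ`. -/
theorem frameWeightQ_mono {θ θ' : ℝ} (hθ : θ ≤ θ') (η : ℝ) (f : ℂ → ℂ) (x₀ s hmax R Hs : ℝ) (B : ℕ) :
    frameWeightQ θ η f x₀ s hmax R Hs B ≤ frameWeightQ θ' η f x₀ s hmax R Hs B :=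
  max_le_max le_rfl (mul_le_mul_of_nonneg_right (mul_le_mul_of_nonneg_right hθ (by positivity)) (sq_nonneg _))

/-- (K) `0 < c ⇒ 0 < c_F`, and `0 ≤ c ⇒ c_F ≤ c`. -/
theorem weightedConstQ_pos {c : ℝ} (hc : 0 < c) (θ η : ℝ) (f : ℂ → ℂ) (x₀ s hmax R Hs : ℝ) (B : ℕ) :
    0 < weightedConstQ c θ η f x₀ s hmax R Hs B :=
  div_pos hc (frameWeightQ_pos θ η f x₀ s hmax R Hs B)

/-- (K) the weighted constant never exceeds `c` (the weight is `≥ 1`). -/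
theorem weightedConstQ_le {c : ℝ} (hc : 0 ≤ c) (θ η : ℝ) (f : ℂ → ℂ) (x₀ s hmax R Hs : ℝ) (B : ℕ) :
    weightedConstQ c θ η f x₀ s hmax R Hs B ≤ c :=
  div_le_self hc (one_le_frameWeightQ θ η f x₀ s hmax R Hs B)

/-- (K) the socket is DOWNWARD-closed in the frame functional (pointwise on legal frames) and UPWARD-closed in the floor. -/
theorem lawWQ_mono {cF cF' : Budget} {L κ₀ κ₀' : ℝ}
    (hc : ∀ (η : ℝ) (f : ℂ → ℂ) (x₀ s hmax R Hs : ℝ) (B : ℕ), EngineHyps5 2 η f x₀ s hmax R Hs B →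
      cF' η f x₀ s hmax R Hs B ≤ cF η f x₀ s hmax R Hs B)
    (hκ : κ₀ ≤ κ₀') (h : TouchedDissipationLawWQ cF L κ₀) : TouchedDissipationLawWQ cF' L κ₀' :=
  fun η f x₀ s hmax R Hs B hE j v z hch hA hlow ht ha hfl =>
    (mul_le_mul_of_nonneg_right (hc η f x₀ s hmax R Hs B hE) (sq_nonneg s)).trans
      (h η f x₀ s hmax R Hs B hE j v z hch hA hlow ht ha (hκ.trans hfl))

/-- (K) a FRAME-BLIND constant implies the weighted law: `W(const c) → T⁗(c, θ)` for `0 ≤ c` (T‴, were it true, would give T⁗ — sanity only; T‴ is dead). -/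
theorem lawTQ_of_const {c L κ₀ : ℝ} (hc : 0 ≤ c) (θ : ℝ) (h : TouchedDissipationLawWQ (fun _ _ _ _ _ _ _ _ => c) L κ₀) :
    TouchedDissipationLawTQ c L κ₀ θ :=
  lawWQ_mono (fun η f x₀ s hmax R Hs B _ => weightedConstQ_le hc θ η f x₀ s hmax R Hs B) le_rfl h

/-- (K) T⁗ is DOWNWARD-closed in `c`, UPWARD-closed in `κ₀` and in `θ` (larger weight slope = weaker law), for `0 ≤ c'`. -/
theorem lawTQ_mono_theta {c c' L κ₀ κ₀' θ θ' : ℝ} (hc' : 0 ≤ c') (hcc : c' ≤ c) (hκ : κ₀ ≤ κ₀') (hθ : θ ≤ θ')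
    (h : TouchedDissipationLawTQ c L κ₀ θ) : TouchedDissipationLawTQ c' L κ₀' θ' := by
  refine lawWQ_mono (fun η f x₀ s hmax R Hs B _ => ?_) hκ h
  have hw := frameWeightQ_pos θ η f x₀ s hmax R Hs B
  calc weightedConstQ c' θ' η f x₀ s hmax R Hs B ≤ c' / frameWeightQ θ η f x₀ s hmax R Hs B :=
        div_le_div_of_nonneg_left hc' hw (frameWeightQ_mono hθ η f x₀ s hmax R Hs B)
    _ ≤ weightedConstQ c θ η f x₀ s hmax R Hs B := div_le_div_of_nonneg_right hcc hw.le

/-- (K) on a row of the socket with `0 < cF(F)` the energy drop is NON-NEGATIVE (the weight is squared). -/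
theorem drop_nonneg_of_lawWQ {cF : Budget} {L κ₀ : ℝ} (h : TouchedDissipationLawWQ cF L κ₀)
    {η : ℝ} {f : ℂ → ℂ} {x₀ s hmax R Hs : ℝ} {B : ℕ} (hE : EngineHyps5 2 η f x₀ s hmax R Hs B) (hcF : 0 < cF η f x₀ s hmax R Hs B)
    {j : ℕ} {v z : ℂ} (hch : Charged (PTrkSQ PBot) StTrkDQ ReadyR2 η f x₀ s hmax R Hs B j) (hA : ApproachLevelQ η f x₀ s hmax R Hs B j)
    (hlow : IsLowest StTrkDQ η f x₀ s hmax R Hs B j v) (ht : Touches f j v z) (ha : AtomicPair f j v z) (hfl : κ₀ ≤ v.im * stateKappa f j v) :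
    0 ≤ (v.im ^ 2 + z.im ^ 2) - childEnergy f j (pairUnion v z) := by
  have hs : 0 < s := hE.2.2.2.1
  have hrow := h η f x₀ s hmax R Hs B hE j v z hch hA hlow ht ha hfl
  by_contra hneg
  push Not at hneg
  have h0 : η ^ 2 * logWeight L Hs (v.im ^ 2 + z.im ^ 2) ^ 2 * ((v.im ^ 2 + z.im ^ 2) - childEnergy f j (pairUnion v z)) ≤ 0 :=
    mul_nonpos_of_nonneg_of_nonpos (by positivity) hneg.le
  nlinarith [mul_pos hcF (pow_pos hs 2)]

/-- (K) the weighted purse identity FIT_W reads: `1/c_F = w_F/c`. -/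
theorem inv_weightedConstQ (c θ η : ℝ) (f : ℂ → ℂ) (x₀ s hmax R Hs : ℝ) (B : ℕ) :
    1 / weightedConstQ c θ η f x₀ s hmax R Hs B = frameWeightQ θ η f x₀ s hmax R Hs B / c := by
  unfold weightedConstQ
  rw [one_div, inv_div]

end RhW08.TouchedDissipationW


/-!
# Glue v5, part 1 (DEFS) — the Φ_L algebra, the level objects with the REPAIRED log-profile potential Φ̃_L, and their bookkeeping (lens-2 g7; (CA680)(D2); 0 sorry)
= §G0/§G1/§G3 of glue v5 `lens2/TouchedGlueW-v1.lean` 1bf6780b (itself = glue v4 dbae8648 + the DECLDIFF `lens2/GLUE-V5-DECLDIFF-v1.md` f8dc3f57), split off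
so that each Theorems file stays ≤ 400 lines (gate lint); part 2 `…R3TouchedGlueW` (Γ2′, Γ3′, the β class law and the composition to ★A) imports this file.
CONTENT: §G0 the pure real functions `gL`, `tangent_core`, ★ `gL_tangent` (v4 verbatim); §G1 the level objects `touchH`, `touchEnergyQ`, `BetaLevelQ κ₀`,
`BetaWitnessQ`, `phiLE`, `firstBetaQ` (the frame's first β-level), `betaPurseWQ (cF : Budget) L`, the REPAIRED potential `betaPotentialWQ cF L κ₀`
(crit-1's PRICE-HOLE repair: `Φ̃_k := purse` for `k < firstBetaQ`, `Φ_L(E_k)` at the frame constant `cF F` from it on — the touch-ON rise is a DROP of Φ̃),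
the retouch rise `retouchRiseWQ` and the rise meter `touchRiseWQ` (nothing booked before the first β-level); §G3 (K) bookkeeping: heights/energies on legal
frames, `phiLE_sub_ge` / `phiLE_mono` / `phiLE_le_purse` (2η ≤ 1), `betaPurseWQ_apply`, `firstBetaQ_le`, `betaPotentialWQ_of_le/of_lt`.
Imports: module W `…R3TouchedDissipationW` (socket, `logWeight`, `frameWeightQ`) + `…R3ColumnImmunity` (strip heredity `RhW08.Column.abs_im_le_of_level`).
Nothing here bears on the truth of RH; RH is not proved; these are definitions and bookkeeping — no law is proved here; ★A / 33346 / 33347 OPEN;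
checked ≠ landed ≠ proved. -/

namespace RhW08.TouchedGlueW

open Complex
open scoped ComplexConjugate
open RhW08.Round1 RhW08.StSwap RhW08.Round2 RhW08.QuadW
open RhW08.SealSwap (PBot)
open RhW08.SealSwapQ RhW08.RateSplit RhW08.BurgersRate RhW08.BurgersRateG3 RhW08.TouchedDissipation RhW08.TouchedDissipationW
open RhIdea6.G17.W07C7 RhIdea6.G17.W07C7.Rev6 RhIdea6.G18.W07C8.Law421BirthS RhIdea6.G19.W07C11.Seam
open RhIdea6.G20.W07C12.Frac RhIdea6.G20.W07C12.StColP RhW07.C12.FieldSplit RhIdea6.G21.W07C13.TentMax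
open RhW07.C14.TwoSided RhW07.C14.Classes RhW07.C14.Lineage RhW07.C14.Booking

/-! ## §G0 The Φ_L algebra (pure real functions; PROVED; v4 verbatim) -/

/-- §G0 `g_L(E) := E·(y² + 2Ly + 2L²)`, `y = logWeight L Hs E`; `Φ_L = (η²/(c s²))·g_L`. -/
noncomputable def gL (L Hs E : ℝ) : ℝ := E * (logWeight L Hs E ^ 2 + 2 * L * logWeight L Hs E + 2 * L ^ 2)

/-- (K) `g_L(0) = 0`. -/
theorem gL_zero (L Hs : ℝ) : gL L Hs 0 = 0 := by simp [gL]

/-- (K) the top value `g_L(2Hs²) = 2Hs²·(1 + 2L + 2L²)` (the purse numerator). -/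
theorem gL_top (L Hs : ℝ) : gL L Hs (2 * Hs ^ 2) = 2 * Hs ^ 2 * (1 + 2 * L + 2 * L ^ 2) := by
  rw [gL, logWeight_top]; ring

/-- (K) `g_L ≥ 0` on `E ≥ 0`. -/
theorem gL_nonneg (L Hs : ℝ) {E : ℝ} (hE : 0 ≤ E) : 0 ≤ gL L Hs E :=
  mul_nonneg hE (by nlinarith [sq_nonneg (logWeight L Hs E + L), sq_nonneg L])

/-- (K) the algebraic core of the tangent inequality: `t ≥ 1 + δ + δ²/2` (`t = e^δ`, `δ ≥ 0`), `y ≥ 1`, `L, E′ ≥ 0`. -/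
theorem tangent_core {L y δ t E' : ℝ} (hL : 0 ≤ L) (hy : 1 ≤ y) (ht : 1 + δ + δ ^ 2 / 2 ≤ t) (hE' : 0 ≤ E') :
    y ^ 2 * (E' * t - E') ≤ E' * t * (y ^ 2 + 2 * L * y + 2 * L ^ 2) - E' * ((y + L * δ) ^ 2 + 2 * L * (y + L * δ) + 2 * L ^ 2) := by
  nlinarith [mul_nonneg (mul_nonneg (mul_nonneg hE' hL) (by linarith : 0 ≤ y + L)) (by linarith : 0 ≤ t - 1 - δ - δ ^ 2 / 2),
    mul_nonneg (mul_nonneg (mul_nonneg hE' hL) (sq_nonneg δ)) (by linarith : (0 : ℝ) ≤ y)]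

/-- ★ (K) TANGENT INEQUALITY = concavity of `g_L` on `(0, 2Hs²]`: `0 ≤ L`, `0 < Hs`, `0 ≤ E′ ≤ E ≤ 2Hs²` ⇒ `y(E)²·(E − E′) ≤ g_L(E) − g_L(E′)`. -/
theorem gL_tangent {L Hs E E' : ℝ} (hL : 0 ≤ L) (hHs : 0 < Hs) (hE'0 : 0 ≤ E') (hE'E : E' ≤ E) (hEA : E ≤ 2 * Hs ^ 2) :
    logWeight L Hs E ^ 2 * (E - E') ≤ gL L Hs E - gL L Hs E' := by
  have hA : 0 < 2 * Hs ^ 2 := by positivity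
  rcases hE'0.eq_or_lt with h0 | hpos
  · rw [← h0, gL_zero, sub_zero, sub_zero, gL]
    have hE0 : 0 ≤ E := h0.le.trans hE'E
    rcases hE0.eq_or_lt with hz | hEpos
    · rw [← hz]; simp
    · have hy := one_le_logWeight hL hEpos hEA
      nlinarith [mul_nonneg (mul_nonneg hL hEpos.le) (by linarith : 0 ≤ logWeight L Hs E + L)]
  · have hEpos : 0 < E := hpos.trans_le hE'E
    have hy1 : 1 ≤ logWeight L Hs E := one_le_logWeight hL hEpos hEA
    set y := logWeight L Hs E with hy_def
    set δ := Real.log E - Real.log E' with hδ_def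
    have hδ0 : 0 ≤ δ := sub_nonneg.2 (Real.log_le_log hpos hE'E)
    set t := Real.exp δ with ht_def
    have hy' : logWeight L Hs E' = y + L * δ := by
      rw [hy_def, hδ_def, logWeight, logWeight, Real.log_div hA.ne' hpos.ne', Real.log_div hA.ne' hEpos.ne']; ring
    have ht : E = E' * t := by
      rw [ht_def, hδ_def, Real.exp_sub, Real.exp_log hEpos, Real.exp_log hpos]; field_simp
    have key := tangent_core hL hy1 (Real.quadratic_le_exp_of_nonneg hδ0) hpos.le (L := L)
    rw [gL, gL, hy', ← hy_def, ht]
    exact key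

/-! ## §G1 Level objects -/

/-- §G1 the TOUCHER HEIGHT of level `j`: `sSup` of `Im z` over the touchers `z` of the lowest band states (`sSup ∅ = 0`). -/
noncomputable def touchH : LevelMeter := fun η f x₀ s hmax R Hs B j =>
  sSup ((fun z : ℂ => z.im) '' {z : ℂ | ∃ v : ℂ, IsLowest StTrkDQ η f x₀ s hmax R Hs B j v ∧ Touches f j v z})

/-- §G1 the PAIR ENERGY meter `E j := lowH j² + touchH j²`. -/
noncomputable def touchEnergyQ : LevelMeter := fun η f x₀ s hmax R Hs B j =>
  lowH StTrkDQ η f x₀ s hmax R Hs B j ^ 2 + touchH η f x₀ s hmax R Hs B j ^ 2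

/-- §G1 the PAID β CLASS: approach levels whose lowest band state is touched by a strictly taller zero, the pair atomic, the field above the floor. -/
def BetaLevelQ (κ₀ : ℝ) : LevelClass := fun η f x₀ s hmax R Hs B j =>
  ApproachLevelQ η f x₀ s hmax R Hs B j ∧
    ∃ v z : ℂ, IsLowest StTrkDQ η f x₀ s hmax R Hs B j v ∧ Touches f j v z ∧ AtomicPair f j v z ∧ κ₀ ≤ v.im * stateKappa f j v

/-- §G1 a β-WITNESS of level `k`: a pair `p = (v, z)` carrying the socket's six level binders. -/
def BetaWitnessQ (κ₀ η : ℝ) (f : ℂ → ℂ) (x₀ s hmax R Hs : ℝ) (B k : ℕ) (p : ℂ × ℂ) : Prop :=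
  Charged (PTrkSQ PBot) StTrkDQ ReadyR2 η f x₀ s hmax R Hs B k ∧ ApproachLevelQ η f x₀ s hmax R Hs B k ∧
    IsLowest StTrkDQ η f x₀ s hmax R Hs B k p.1 ∧ Touches f k p.1 p.2 ∧ AtomicPair f k p.1 p.2 ∧ κ₀ ≤ p.1.im * stateKappa f k p.1

/-- §G1 `Φ_L(E) = (η²/(c s²))·g_L(E)` at a (frame) constant `c`. -/
noncomputable def phiLE (c L η s Hs E : ℝ) : ℝ := η ^ 2 / (c * s ^ 2) * gL L Hs E

open Classical in
/-- §G1 the FIRST β-LEVEL of a frame: `sInf {k | BetaLevelQ κ₀ k}` (junk `0` if there is none — then no β-level is ever booked). -/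
noncomputable def firstBetaQ (κ₀ η : ℝ) (f : ℂ → ℂ) (x₀ s hmax R Hs : ℝ) (B : ℕ) : ℕ :=
  sInf {k : ℕ | BetaLevelQ κ₀ η f x₀ s hmax R Hs B k}

/-- §G1 the β PURSE at the frame constant: `(1 + 2L + 2L²)·(Hs/s)²/(2·cF(F))` (`= Φ_L(2Hs²)` at `η = 1/2`). -/
noncomputable def betaPurseWQ (cF : Budget) (L : ℝ) : Budget := fun η f x₀ s hmax R Hs B =>
  (1 + 2 * L + 2 * L ^ 2) * (Hs / s) ^ 2 / (2 * cF η f x₀ s hmax R Hs B)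

/-- §G1 the REPAIRED β POTENTIAL `Φ̃_k`: the full purse before the first β-level, `Φ_L(E k)` (at the frame constant `cF(F)`) from it on. -/
noncomputable def betaPotentialWQ (cF : Budget) (L κ₀ : ℝ) : LevelMeter := fun η f x₀ s hmax R Hs B k =>
  if k < firstBetaQ κ₀ η f x₀ s hmax R Hs B then betaPurseWQ cF L η f x₀ s hmax R Hs B
  else phiLE (cF η f x₀ s hmax R Hs B) L η s Hs (touchEnergyQ η f x₀ s hmax R Hs B k)

open Classical in
/-- §G1 the RETOUCH RISE `RTB_k := [Φ_L(E (k+1)) − Φ_L(childEnergy Ū_k)]⁺` at a level with a β-witness (`Ū_k` of a CHOSEN witness; every law binder is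
`∀ v z`, so the choice is immaterial — Γ3′ is priced at the WORST toucher), else `0`. -/
noncomputable def retouchRiseWQ (cF : Budget) (L κ₀ : ℝ) : LevelMeter := fun η f x₀ s hmax R Hs B k =>
  if h : ∃ p : ℂ × ℂ, BetaWitnessQ κ₀ η f x₀ s hmax R Hs B k p then
    max (phiLE (cF η f x₀ s hmax R Hs B) L η s Hs (touchEnergyQ η f x₀ s hmax R Hs B (k + 1))
      - phiLE (cF η f x₀ s hmax R Hs B) L η s Hs (childEnergy f k (pairUnion (Classical.choose h).1 (Classical.choose h).2))) 0
  else 0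

/-- §G1 the RISE METER on Φ̃: `max([Φ̃(k+1) − Φ̃(k)]⁺, RTB_k) + 4·[−drop_k]⁺/s` (nothing is booked before the first β-level: Φ̃ is constant there). -/
noncomputable def touchRiseWQ (cF : Budget) (L κ₀ : ℝ) : LevelMeter := fun η f x₀ s hmax R Hs B k =>
  max (max (betaPotentialWQ cF L κ₀ η f x₀ s hmax R Hs B (k + 1) - betaPotentialWQ cF L κ₀ η f x₀ s hmax R Hs B k) 0)
      (retouchRiseWQ cF L κ₀ η f x₀ s hmax R Hs B k)
    + 4 * max (-dropQ η f x₀ s hmax R Hs B k) 0 / s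

/-! ## §G3 Bookkeeping of the level objects (K) -/

/-- (K) the lowest band height is at most `Hs` on a legal frame. -/
theorem lowH_le_Hs {η : ℝ} {f : ℂ → ℂ} {x₀ s hmax R Hs : ℝ} {B : ℕ} (hE : EngineHyps5 2 η f x₀ s hmax R Hs B) (k : ℕ) :
    lowH StTrkDQ η f x₀ s hmax R Hs B k ≤ Hs := by
  have hHs : 0 ≤ Hs := hE.2.2.2.2.2.2.2.1
  by_cases hex : ∃ u : ℂ, StTrkDQ η f x₀ s hmax R Hs B k u
  · obtain ⟨u, hu⟩ := hex
    exact (lowH_le hu).trans (RhW08.Column.abs_im_le_of_level hE hu.1 hu.2.1)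
  · have hset : {u : ℂ | StTrkDQ η f x₀ s hmax R Hs B k u} = ∅ := by
      ext u
      simp only [Set.mem_setOf_eq, Set.mem_empty_iff_false, iff_false]
      exact fun hu => hex ⟨u, hu⟩
    show sInf ((fun u : ℂ => |u.im|) '' {u : ℂ | StTrkDQ η f x₀ s hmax R Hs B k u}) ≤ Hs
    rw [hset, Set.image_empty, Real.sInf_empty]
    exact hHs

/-- (K) the touch height is non-negative. -/
theorem touchH_nonneg (η : ℝ) (f : ℂ → ℂ) (x₀ s hmax R Hs : ℝ) (B k : ℕ) : 0 ≤ touchH η f x₀ s hmax R Hs B k := by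
  refine Real.sSup_nonneg ?_
  rintro x ⟨z, ⟨v, hlow, ht⟩, rfl⟩
  exact ((hlow.1.2.2.1).trans ht.2.1).le

/-- (K) the touch height is at most `Hs` on a legal frame. -/
theorem touchH_le_Hs {η : ℝ} {f : ℂ → ℂ} {x₀ s hmax R Hs : ℝ} {B : ℕ} (hE : EngineHyps5 2 η f x₀ s hmax R Hs B) (k : ℕ) :
    touchH η f x₀ s hmax R Hs B k ≤ Hs := by
  refine Real.sSup_le ?_ hE.2.2.2.2.2.2.2.1
  rintro x ⟨z, ⟨v, hlow, ht⟩, rfl⟩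
  exact (le_abs_self _).trans (RhW08.Column.abs_im_le_of_level hE hlow.1.1 ht.1)

/-- (K) the touch energy is non-negative. -/
theorem touchEnergyQ_nonneg (η : ℝ) (f : ℂ → ℂ) (x₀ s hmax R Hs : ℝ) (B k : ℕ) : 0 ≤ touchEnergyQ η f x₀ s hmax R Hs B k := by
  unfold touchEnergyQ; positivity

/-- (K) the touch energy is at most `2Hs²` on a legal frame. -/
theorem touchEnergyQ_le {η : ℝ} {f : ℂ → ℂ} {x₀ s hmax R Hs : ℝ} {B : ℕ} (hE : EngineHyps5 2 η f x₀ s hmax R Hs B) (k : ℕ) :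
    touchEnergyQ η f x₀ s hmax R Hs B k ≤ 2 * Hs ^ 2 := by
  have h1 : lowH StTrkDQ η f x₀ s hmax R Hs B k ^ 2 ≤ Hs ^ 2 := pow_le_pow_left₀ lowH_nonneg' (lowH_le_Hs hE k) 2
  have h2 : touchH η f x₀ s hmax R Hs B k ^ 2 ≤ Hs ^ 2 :=
    pow_le_pow_left₀ (touchH_nonneg η f x₀ s hmax R Hs B k) (touchH_le_Hs hE k) 2
  unfold touchEnergyQ; linarith

/-- (K) at a level with lowest band state `v` touched by `z`: `Im v² + Im z² ≤ E k`. -/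
theorem pair_le_touchEnergyQ {η : ℝ} {f : ℂ → ℂ} {x₀ s hmax R Hs : ℝ} {B k : ℕ} {v z : ℂ} (hE : EngineHyps5 2 η f x₀ s hmax R Hs B)
    (hlow : IsLowest StTrkDQ η f x₀ s hmax R Hs B k v) (ht : Touches f k v z) :
    v.im ^ 2 + z.im ^ 2 ≤ touchEnergyQ η f x₀ s hmax R Hs B k := by
  have hL : lowH StTrkDQ η f x₀ s hmax R Hs B k = v.im := lowH_eq_of_isLowest hlow
  have hbdd : BddAbove ((fun z : ℂ => z.im) '' {z : ℂ | ∃ v : ℂ, IsLowest StTrkDQ η f x₀ s hmax R Hs B k v ∧ Touches f k v z}) := by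
    refine ⟨Hs, ?_⟩
    rintro x ⟨z', ⟨v', hlow', ht'⟩, rfl⟩
    exact (le_abs_self _).trans (RhW08.Column.abs_im_le_of_level hE hlow'.1.1 ht'.1)
  have hz : z.im ≤ touchH η f x₀ s hmax R Hs B k := le_csSup hbdd ⟨z, ⟨v, hlow, ht⟩, rfl⟩
  have hz2 : z.im ^ 2 ≤ touchH η f x₀ s hmax R Hs B k ^ 2 := pow_le_pow_left₀ ((hlow.1.2.2.1.trans ht.2.1).le) hz 2
  unfold touchEnergyQ; rw [hL]; linarith

/-- (K) a touched lowest pair on a legal frame sits in the strip: `Im v² + Im z² ≤ 2Hs²` and `0 < Hs`. -/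
theorem pair_le_twoHsSq {η : ℝ} {f : ℂ → ℂ} {x₀ s hmax R Hs : ℝ} {B k : ℕ} {v z : ℂ} (hE : EngineHyps5 2 η f x₀ s hmax R Hs B)
    (hlow : IsLowest StTrkDQ η f x₀ s hmax R Hs B k v) (ht : Touches f k v z) :
    v.im ^ 2 + z.im ^ 2 ≤ 2 * Hs ^ 2 ∧ 0 < Hs := by
  have hv : |v.im| ≤ Hs := RhW08.Column.abs_im_le_of_level hE hlow.1.1 hlow.1.2.1
  have hz : |z.im| ≤ Hs := RhW08.Column.abs_im_le_of_level hE hlow.1.1 ht.1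
  have hv2 : v.im ^ 2 ≤ Hs ^ 2 := by rw [← sq_abs]; exact pow_le_pow_left₀ (abs_nonneg _) hv 2
  have hz2 : z.im ^ 2 ≤ Hs ^ 2 := by rw [← sq_abs]; exact pow_le_pow_left₀ (abs_nonneg _) hz 2
  exact ⟨by linarith, hlow.1.2.2.1.trans_le ((le_abs_self _).trans hv)⟩

/-- (K) `Φ_L ≥ 0` on `E ≥ 0` (for `0 < c`). -/
theorem phiLE_nonneg {c : ℝ} (hc : 0 < c) (L η s Hs : ℝ) {E : ℝ} (hE : 0 ≤ E) : 0 ≤ phiLE c L η s Hs E := by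
  unfold phiLE
  exact mul_nonneg (div_nonneg (sq_nonneg η) (mul_nonneg hc.le (sq_nonneg s))) (gL_nonneg L Hs hE)

/-- ★ (K) THE PAYING INEQUALITY of Φ_L: `0 ≤ E′ ≤ E ≤ 2Hs²` ⇒ `(η²/(c s²))·y(E)²·(E − E′) ≤ Φ_L(E) − Φ_L(E′)`. -/
theorem phiLE_sub_ge {c L η s Hs E E' : ℝ} (hc : 0 < c) (hL : 0 ≤ L) (hHs : 0 < Hs) (hE'0 : 0 ≤ E') (hE'E : E' ≤ E)
    (hEA : E ≤ 2 * Hs ^ 2) : η ^ 2 / (c * s ^ 2) * (logWeight L Hs E ^ 2 * (E - E')) ≤ phiLE c L η s Hs E - phiLE c L η s Hs E' := by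
  unfold phiLE; rw [← mul_sub]
  exact mul_le_mul_of_nonneg_left (gL_tangent hL hHs hE'0 hE'E hEA) (div_nonneg (sq_nonneg η) (mul_nonneg hc.le (sq_nonneg s)))

/-- (K) `Φ_L` is monotone in `E` on `[0, 2Hs²]`. -/
theorem phiLE_mono {c L η s Hs E E' : ℝ} (hc : 0 < c) (hL : 0 ≤ L) (hHs : 0 < Hs) (hE'0 : 0 ≤ E') (hE'E : E' ≤ E)
    (hEA : E ≤ 2 * Hs ^ 2) : phiLE c L η s Hs E' ≤ phiLE c L η s Hs E := by
  have h := phiLE_sub_ge (η := η) (s := s) hc hL hHs hE'0 hE'E hEA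
  have h0 : 0 ≤ η ^ 2 / (c * s ^ 2) * (logWeight L Hs E ^ 2 * (E - E')) :=
    mul_nonneg (div_nonneg (sq_nonneg η) (mul_nonneg hc.le (sq_nonneg s))) (mul_nonneg (sq_nonneg _) (sub_nonneg.2 hE'E))
  linarith

/-- ★ (K) THE PURSE of Φ_L: `0 ≤ E ≤ 2Hs²`, `0 ≤ Hs`, `0 ≤ η ≤ 1/2` ⇒ `Φ_L(E) ≤ (1 + 2L + 2L²)·(Hs/s)²/(2c)`. -/
theorem phiLE_le_purse {c L η s Hs E : ℝ} (hc : 0 < c) (hL : 0 ≤ L) (hs : 0 < s) (hη0 : 0 ≤ η) (hη1 : 2 * η ≤ 1) (hHs : 0 ≤ Hs)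
    (hE0 : 0 ≤ E) (hEA : E ≤ 2 * Hs ^ 2) : phiLE c L η s Hs E ≤ (1 + 2 * L + 2 * L ^ 2) * (Hs / s) ^ 2 / (2 * c) := by
  have hη2 : η ^ 2 ≤ 1 / 4 := by nlinarith
  have hq : 0 ≤ 1 + 2 * L + 2 * L ^ 2 := by nlinarith
  rcases hHs.eq_or_lt with hz | hHs'
  · have hE : E = 0 := le_antisymm (by rw [← hz] at hEA; simpa using hEA) hE0
    rw [hE, phiLE, gL_zero, mul_zero]
    positivity
  · have htop : gL L Hs E ≤ 2 * Hs ^ 2 * (1 + 2 * L + 2 * L ^ 2) := by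
      have h := gL_tangent hL hHs' hE0 hEA le_rfl
      rw [gL_top, logWeight_top] at h
      nlinarith
    have hcoef : 0 ≤ η ^ 2 / (c * s ^ 2) := by positivity
    calc phiLE c L η s Hs E = η ^ 2 / (c * s ^ 2) * gL L Hs E := rfl
      _ ≤ η ^ 2 / (c * s ^ 2) * (2 * Hs ^ 2 * (1 + 2 * L + 2 * L ^ 2)) := mul_le_mul_of_nonneg_left htop hcoef
      _ = 2 * Hs ^ 2 * (1 + 2 * L + 2 * L ^ 2) / (c * s ^ 2) * η ^ 2 := by ring
      _ ≤ 2 * Hs ^ 2 * (1 + 2 * L + 2 * L ^ 2) / (c * s ^ 2) * (1 / 4) :=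
          mul_le_mul_of_nonneg_left hη2 (by positivity)
      _ = (1 + 2 * L + 2 * L ^ 2) * (Hs / s) ^ 2 / (2 * c) := by field_simp; ring

/-- (K) per-frame reading of the β purse. -/
theorem betaPurseWQ_apply (cF : Budget) (L η : ℝ) (f : ℂ → ℂ) (x₀ s hmax R Hs : ℝ) (B : ℕ) :
    betaPurseWQ cF L η f x₀ s hmax R Hs B = (1 + 2 * L + 2 * L ^ 2) * (Hs / s) ^ 2 / (2 * cF η f x₀ s hmax R Hs B) := rfl

/-- (K) a β-level is not before the first β-level. -/
theorem firstBetaQ_le {κ₀ η : ℝ} {f : ℂ → ℂ} {x₀ s hmax R Hs : ℝ} {B k : ℕ} (hk : BetaLevelQ κ₀ η f x₀ s hmax R Hs B k) :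
    firstBetaQ κ₀ η f x₀ s hmax R Hs B ≤ k :=
  Nat.sInf_le hk

/-- (K) the two cases of Φ̃. -/
theorem betaPotentialWQ_of_le {cF : Budget} {L κ₀ η : ℝ} {f : ℂ → ℂ} {x₀ s hmax R Hs : ℝ} {B k : ℕ}
    (hk : firstBetaQ κ₀ η f x₀ s hmax R Hs B ≤ k) : betaPotentialWQ cF L κ₀ η f x₀ s hmax R Hs B k
      = phiLE (cF η f x₀ s hmax R Hs B) L η s Hs (touchEnergyQ η f x₀ s hmax R Hs B k) := by
  unfold betaPotentialWQ; rw [if_neg (not_lt.2 hk)]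

/-- (K) before the first β-level the repaired potential is the purse. -/
theorem betaPotentialWQ_of_lt {cF : Budget} {L κ₀ η : ℝ} {f : ℂ → ℂ} {x₀ s hmax R Hs : ℝ} {B k : ℕ}
    (hk : k < firstBetaQ κ₀ η f x₀ s hmax R Hs B) :
    betaPotentialWQ cF L κ₀ η f x₀ s hmax R Hs B k = betaPurseWQ cF L η f x₀ s hmax R Hs B := by
  unfold betaPotentialWQ; rw [if_pos hk]

end RhW08.TouchedGlueW
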